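import Summits.ABC.IUTFork.Repair.RHHeightClassGlue
import HarnessLib

/-!
# R-H ROUND 1 (D-0079, D-0107), rows 8 «heightclass» / 15 «slotreach» — the MOVER LEMMA at the row-8 dictionary:
# `SlotReachWindow` at `n₀ ≡ 1` (odd residue characteristic under the bad places) ⟹ abc-iut-w5-d107's MULTI-REACH ⟹ S_H

PROOF-ONLY file (D-0012: 0 definitions, 0 `Prop` facts; abc-iut cell, rung LADDER-ABC:A2.RP → A2.RESCUE.H; seat abc-iut-rp-m2 gen 5 =
R-H k2 DESK hand #8, row 8 of `plan/rescue/R-H/RH-CANDIDATES.tsv`; parallel vehicle to abc-iut-rp-d3's general mover lemma for row 15,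
specialised to the case row 8 needs: inner-conductor bound `n₀ ≡ 1`, `p` odd under the bad places). TAKES NO SIDE on [IUTchIII] Cor. 3.12
or on any author; every R-H candidate is a HYPOTHESIS; typed ≠ proved; instantiated ≠ endorsed.

THE ARGUMENT (Weil *BNT* II §2 Th. 1 through abc-iut-w5-d180's `Thm311.Real.exists_mem_ismDH_apply_eq_of_primitive`: Dupuy–Hilado's (Ind2)
group `Real.ismDH` is TRANSITIVE on the primitive vectors of every homothetic copy `c·Λ_x`, `Λ_x = log_p(𝒪_x^×)`). Fix a prime `p > 2` and the
dictionary of `Repair.RHSlotReach.SlotReachWindow` at `n₀ ≡ 1`: at every place `x ∣ p` a NON-member `u_x ∉ Λ_x` with `‖u_x‖ ≤ 1`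
(`RHSlotReach.exists_hsharp_one`) and a member `z_x ∈ Λ_x` with `‖z_x‖ ≥ p^{λ_x}` (`RHHeightClassGlue.exists_mem_logUnits_rpow_le_of_certVal`).
* §1 `exists_primitive_norm_ge` — `z_x` may be taken PRIMITIVE (`∈ Λ ∖ pΛ`; divide by `p` while possible, `Λ` is compact);
  `p_smul_mem_logUnits_of_norm_le_one` — `p·𝒪_x ⊆ Λ_x` for `p` odd (`𝔪^{⌊e/(p−1)⌋+1} ⊆ Λ`, `⌊e/(p−1)⌋+1 ≤ e`), so `p·u_x ∈ Λ ∖ pΛ`.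
* §2 DONOR slot (`exists_donor_mover`): `u_x` is primitive at content `p⁻¹`, hence is carried onto `p⁻¹·z′` — reach `p^{λ_x + 1}` with the
  integral multiplier `y = u_x`. ACTIVE slot (`exists_active_mover`): for `‖t_Θ‖ = ‖ϖ_w‖^{M}` put `k = ⌊(M−1)/e_w⌋` and `y′ = p^{k+1}u_w/t_Θ`
  (`‖y′‖ ≤ 1`); `t_Θ·y′ = p^k·(p u_w)` is primitive at content `p^k`, hence is carried onto `p^k·z′` — reach `p^{λ_w − k}`.
* §3 `exists_donor_mover_at` / `exists_active_mover_at` — the same two movers at a fibre point `x ∣ p` of a Dupuy–Hilado pilot datum, read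
  through the presentation `φ_x = id` of abc-iut-c312-5's real signature (`presAt`), in `rpow` currency: reaches `p^{λ_x + 1}` (donor, multiplier
  `y = u_x`) and `p^{λ_w − ⌊(mΘ−1)/e_w⌋}` (active, `‖t_Θ‖ = p^{−mΘ/e_w}`), given a certified outer radius `p^{λ} ≤ ‖z‖`, `z ∈ log_p 𝒪^×`
  (`RHHeightClassGlue.exists_mem_logUnits_rpow_le_of_certVal`); the non-member `u` is abc-iut-rh-typ-12's
  `RHSlotReach.exists_norm_le_one_not_mem_logUnits`. The ASSEMBLY «`SlotReachWindow` at `n₀ ≡ 1` ⟹ multi-reach at every packet ⟹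
  `∃ ρ qK, QPinned ∧ PilotKummerCompatHull` at `settingPrVolSharp`» is the sequel file `Repair.RHSlotReachMoverOddAssembly`.
HONEST SCOPE. OUR typed sharp containers and Dupuy–Hilado's typed (Ind2); STRONGER-THAN-PRINT hull reading (ADJUDICATION-SPEC §2 (G1′)); nothing
about the printed GLOBAL inequality; nothing evaluates the candidate on the table (k1: abc-iut-rh-num-1). [cite: WeilBNT1967, Ch. II §2, Th. 1]
[cite: DupuyHilado2025, §3.9, §4.9] [cite: NeukirchANT1999, Ch. II Prop. (5.5)] [cite: Mochizuki2012, IUTchIII Thm. 3.11 (i) (Ind2) p. 154,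
Cor. 3.12 p. 173–174, Step (xi-f) p. 184] [claim: Mochizuki2012, status: disputed] for every IUT locution.
-/

noncomputable section

open Set Metric Function
open scoped Pointwise

namespace Summit.ABC.IUTFork.Repair.RHSlotReachMoverOdd

/-! ## §1. Lattice lemmas in one `p`-adic field: primitive reduction, `p·𝒪 ⊆ log_p 𝒪^×` for `p` odd -/

section LocalField

open Literature.IUT.LogVolume Literature.NumberTheory.GaloisRepresentations.Ultrametric

variable (p : ℕ) [hp : Fact p.Prime] {K : Type*} [NontriviallyNormedField K] [instK : NormedAlgebra ℚ_[p] K] [IsUltrametricDist K]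
  [ProperSpace K]

include instK in
/-- **PRIMITIVE REDUCTION.** A non-zero unit logarithm `z ∈ Λ = log_p(𝒪_K^×)` can be divided by `p` until it is PRIMITIVE (`∈ Λ ∖ p·Λ`),
which only increases its norm: `∃ z′ ∈ Λ ∖ pΛ, ‖z‖ ≤ ‖z′‖` (`Λ` is compact, hence bounded; `Λ` is a `ℤ_p`-module).
[cite: WeilBNT1967, Ch. II §2, Th. 1] -/
theorem exists_primitive_norm_ge {z : K} (hz : z ∈ logUnits K) (hz0 : z ≠ 0) :
    ∃ z' ∈ logUnits K, z' ∉ (p : ℚ_[p]) • (logUnits K : Set K) ∧ ‖z‖ ≤ ‖z'‖ := by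
  classical
  have hp0 : (p : ℚ_[p]) ≠ 0 := Nat.cast_ne_zero.mpr hp.out.ne_zero
  have hp1 : (1 : ℝ) < p := by exact_mod_cast hp.out.one_lt
  have hzpos : 0 < ‖z‖ := norm_pos_iff.mpr hz0
  obtain ⟨C, hC⟩ := (isCompact_logUnits p K).isBounded.exists_norm_le
  have hnorm : ∀ m : ℕ, ‖((p : ℚ_[p])⁻¹) ^ m • z‖ = (p : ℝ) ^ m * ‖z‖ := fun m => by
    rw [norm_smul, norm_pow, norm_inv, Padic.norm_p, inv_inv]
  obtain ⟨m₁, hm₁⟩ := pow_unbounded_of_one_lt (C / ‖z‖) hp1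
  have hex : ∃ m : ℕ, ((p : ℚ_[p])⁻¹) ^ (m + 1) • z ∉ logUnits K := by
    refine ⟨m₁, fun hmem => ?_⟩
    have h := hC _ hmem
    rw [hnorm] at h
    rw [div_lt_iff₀ hzpos] at hm₁
    have hmono : (p : ℝ) ^ m₁ ≤ (p : ℝ) ^ (m₁ + 1) := pow_le_pow_right₀ hp1.le (by omega)
    nlinarith
  obtain ⟨hspec, hmin⟩ : ((p : ℚ_[p])⁻¹) ^ (Nat.find hex + 1) • z ∉ logUnits K ∧
      ∀ m < Nat.find hex, ¬ (((p : ℚ_[p])⁻¹) ^ (m + 1) • z ∉ logUnits K) :=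
    ⟨Nat.find_spec hex, fun m hm => Nat.find_min hex hm⟩
  have hmem : ((p : ℚ_[p])⁻¹) ^ (Nat.find hex) • z ∈ logUnits K := by
    rcases Nat.eq_zero_or_pos (Nat.find hex) with h0 | hpos
    · rw [h0, pow_zero, one_smul]; exact hz
    · have h := hmin (Nat.find hex - 1) (by omega)
      rw [not_not, Nat.sub_add_cancel hpos] at h
      exact h
  refine ⟨_, hmem, fun hmem' => hspec ?_, ?_⟩
  · rw [Set.mem_smul_set_iff_inv_smul_mem₀ hp0] at hmem'
    rw [pow_succ', mul_smul]
    exact hmem'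
  · rw [hnorm]
    exact le_mul_of_one_le_left hzpos.le (one_le_pow₀ hp1.le)

include instK in
/-- **`p·𝒪_K ⊆ log_p(𝒪_K^×)` for `p` odd**: `‖p·u‖ ≤ ‖p‖ = ‖ϖ‖^e ≤ ‖ϖ‖^{⌊e/(p−1)⌋+1}` and that ball lies in `Λ` (abc-iut-c312-3
`LogEnvelope.closedBall_div_succ_subset_logUnits`; `⌊e/(p−1)⌋+1 ≤ e` needs `p ≥ 3`). [cite: NeukirchANT1999, Ch. II Prop. (5.5)] -/
theorem p_smul_mem_logUnits_of_norm_le_one (hp2 : 2 < p) {u : K} (hu1 : ‖u‖ ≤ 1) : (p : ℚ_[p]) • u ∈ logUnits K := by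
  have hϖ := isUniformizer_unifChoice K
  refine LogEnvelope.closedBall_div_succ_subset_logUnits p hϖ ?_
  rw [mem_closedBall_zero_iff, norm_smul, Padic.norm_p, ← norm_pow_absRamificationIdx p K hϖ]
  have he1 : 1 ≤ absRamificationIdx p K := absRamificationIdx_pos p K
  have hle : absRamificationIdx p K / (p - 1) + 1 ≤ absRamificationIdx p K := by
    have h2 : absRamificationIdx p K / (p - 1) ≤ absRamificationIdx p K / 2 := Nat.div_le_div_left (by omega) (by omega)
    omega
  calc ‖(unifChoice K : K)‖ ^ absRamificationIdx p K * ‖u‖ ≤ ‖(unifChoice K : K)‖ ^ absRamificationIdx p K :=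
        mul_le_of_le_one_right (pow_nonneg (norm_nonneg _) _) hu1
    _ ≤ ‖(unifChoice K : K)‖ ^ (absRamificationIdx p K / (p - 1) + 1) := pow_le_pow_of_le_one (norm_nonneg _) hϖ.1.le hle

include instK in
/-- **For `p` odd, a NON-member `u ∉ Λ` with `‖u‖ ≤ 1` gives the PRIMITIVE vector `p·u ∈ Λ ∖ pΛ`** (equivalently: `u` is primitive at content
`p⁻¹`). [cite: WeilBNT1967, Ch. II §2, Th. 1] -/
theorem p_smul_primitive (hp2 : 2 < p) {u : K} (hu : u ∉ logUnits K) (hu1 : ‖u‖ ≤ 1) :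
    (p : ℚ_[p]) • u ∈ logUnits K ∧ (p : ℚ_[p]) • u ∉ (p : ℚ_[p]) • (logUnits K : Set K) := by
  have hp0 : (p : ℚ_[p]) ≠ 0 := Nat.cast_ne_zero.mpr hp.out.ne_zero
  exact ⟨p_smul_mem_logUnits_of_norm_le_one p hp2 hu1, fun h => hu ((Set.smul_mem_smul_set_iff₀ hp0 _ _).1 h)⟩

omit hp instK in
/-- `⌊−1/e⌋ = −1` for `e ≥ 1` (Lean's `/` on `ℤ` is Euclidean), so `⌈1/e⌉ = −⌊−1/e⌋ = 1`: the donor term of `SlotReachWindow` at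
`n₀ = 1` is `λ + 1`. [folklore] -/
theorem neg_one_ediv {e : ℤ} (he : 1 ≤ e) : (-1 : ℤ) / e = -1 :=
  ((Int.ediv_emod_unique (a := -1) (b := e) (r := e - 1) (q := -1) (by omega)).2 ⟨by ring, by omega, by omega⟩).1

omit hp instK in
/-- `M ≤ e·(⌊(M−1)/e⌋ + 1)` for `e ≥ 1`: the active multiplier `y′ = p^{k+1}u/t_Θ`, `k = ⌊(M−1)/e⌋`, is integral. [folklore] -/
theorem le_mul_ediv_sub_one_add_one {e : ℤ} (he : 1 ≤ e) (M : ℤ) : M ≤ e * ((M - 1) / e + 1) := by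
  have h1 := Int.mul_ediv_add_emod (M - 1) e
  have h2 := Int.emod_lt_of_pos (M - 1) (show 0 < e by omega)
  nlinarith

end LocalField

/-! ## §2. The two movers at a place `v ∣ p` (`p` odd): DONOR slot and ACTIVE slot -/

section Place

open NumberField IsDedekindDomain Literature.IUT.LogVolume Literature.NumberTheory.NumberFields
  Literature.NumberTheory.GaloisRepresentations.Ultrametric Summit.ABC.IUTFork.Thm311 Summit.ABC.IUTFork.Thm311.Real

variable {F : Type} [Field F] [NumberField F] {p : ℕ} [hp : Fact p.Prime] {logv : PadicLogs F} (hlog : LogvAnalyticAt p logv)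
  (v : HeightOneSpectrum (𝓞 F)) (hv : ((p : ℕ) : 𝓞 F) ∈ v.asIdeal)

include hlog in
/-- **DONOR MOVER** (`p` odd). From a NON-member `u ∉ Λ_v` with `‖u‖ ≤ 1` and a non-zero member `z ∈ Λ_v`: some `g ∈ Real.ismDH logv v`
carries `u` to an element of norm `≥ p·‖z‖` — `u` is primitive at content `p⁻¹` (`p·u ∈ Λ ∖ pΛ`), the target `p⁻¹·z′` with `z′ ∈ Λ ∖ pΛ`,
`‖z′‖ ≥ ‖z‖` is primitive at the same content; transitivity (abc-iut-w5-d180). With `‖z‖ ≥ p^λ` the reach is `p^{λ+1}`.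
[cite: WeilBNT1967, Ch. II §2, Th. 1] [cite: DupuyHilado2025, §4.9] -/
theorem exists_donor_mover (hp2 : 2 < p) {u z : RescaledCompletion F p v hv}
    (hu : u ∉ (logUnits (RescaledCompletion F p v hv) : Set (RescaledCompletion F p v hv))) (hu1 : ‖u‖ ≤ 1)
    (hz : z ∈ (logUnits (RescaledCompletion F p v hv) : Set (RescaledCompletion F p v hv))) (hz0 : z ≠ 0) :
    ∃ g ∈ ismDH logv (.inr v), (p : ℝ) * ‖z‖ ≤ ‖toR p v hv (g (ofR p v hv u))‖ := by
  have hp0 : (p : ℚ_[p]) ≠ 0 := Nat.cast_ne_zero.mpr hp.out.ne_zero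
  obtain ⟨z', hz', hz'p, hzz'⟩ := exists_primitive_norm_ge p hz hz0
  obtain ⟨hpu, hpup⟩ := p_smul_primitive p hp2 hu hu1
  -- `u` and `p⁻¹ • z'` are primitive vectors of `p⁻¹ • Λ`
  have hc1 : (p : ℚ_[p]) * (p : ℚ_[p])⁻¹ = 1 := mul_inv_cancel₀ hp0
  have hu' : u ∈ (p : ℚ_[p])⁻¹ • (logUnits (RescaledCompletion F p v hv) : Set (RescaledCompletion F p v hv)) := by
    rw [Set.mem_smul_set_iff_inv_smul_mem₀ (inv_ne_zero hp0), inv_inv]; exact hpu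
  have hu'p : u ∉ ((p : ℚ_[p]) * (p : ℚ_[p])⁻¹) • (logUnits (RescaledCompletion F p v hv) : Set (RescaledCompletion F p v hv)) := by
    rw [hc1, one_smul]; exact hu
  have hy' : (p : ℚ_[p])⁻¹ • z' ∈ (p : ℚ_[p])⁻¹ • (logUnits (RescaledCompletion F p v hv) : Set (RescaledCompletion F p v hv)) := Set.smul_mem_smul_set hz'
  have hy'p : (p : ℚ_[p])⁻¹ • z' ∉ ((p : ℚ_[p]) * (p : ℚ_[p])⁻¹) • (logUnits (RescaledCompletion F p v hv) : Set (RescaledCompletion F p v hv)) := by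
    rw [hc1, one_smul]
    intro h
    apply hz'p
    rw [Set.mem_smul_set_iff_inv_smul_mem₀ hp0]; exact h
  obtain ⟨g, hg, hgu⟩ := exists_mem_ismDH_apply_eq_of_primitive hlog v hv hu' hu'p hy' hy'p
  refine ⟨g, hg, ?_⟩
  rw [hgu, norm_smul, norm_inv, Padic.norm_p, inv_inv]
  exact mul_le_mul_of_nonneg_left hzz' (by positivity)

include hlog in
/-- **ACTIVE MOVER** (`p` odd). From `u ∉ Λ_v`, `‖u‖ ≤ 1`, a non-zero member `z ∈ Λ_v`, and an idele coordinate `t` with `‖t‖ = ‖ϖ_v‖^M`: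
with `k := ⌊(M−1)/e_v⌋` the multiplier `y′ := p^{k+1}u/t` is integral and `t·y′ = p^k·(p u)` is primitive at content `p^k`, so some
`g ∈ Real.ismDH logv v` carries `t·y′` to `p^k·z′` — norm `≥ ‖p‖^k·‖z‖`. [cite: WeilBNT1967, Ch. II §2, Th. 1] [cite: DupuyHilado2025, §4.9] -/
theorem exists_active_mover (hp2 : 2 < p) {ϖ : (RescaledCompletion F p v hv)ˣ} (hϖ : IsUniformizer ϖ)
    {u z t : RescaledCompletion F p v hv}
    (hu : u ∉ (logUnits (RescaledCompletion F p v hv) : Set (RescaledCompletion F p v hv))) (hu1 : ‖u‖ ≤ 1)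
    (hz : z ∈ (logUnits (RescaledCompletion F p v hv) : Set (RescaledCompletion F p v hv))) (hz0 : z ≠ 0)
    {M : ℤ} (ht : ‖t‖ = ‖(ϖ : RescaledCompletion F p v hv)‖ ^ M) :
    ∃ g ∈ ismDH logv (.inr v), ∃ y : RescaledCompletion F p v hv, ‖y‖ ≤ 1 ∧
      ‖(p : ℚ_[p])‖ ^ ((M - 1) / (absRamificationIdx p (RescaledCompletion F p v hv) : ℤ)) * ‖z‖ ≤
        ‖toR p v hv (g (ofR p v hv (t * y)))‖ := by
  set e : ℕ := absRamificationIdx p (RescaledCompletion F p v hv) with he_def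
  set k : ℤ := (M - 1) / (e : ℤ) with hk_def
  have hp0 : (p : ℚ_[p]) ≠ 0 := Nat.cast_ne_zero.mpr hp.out.ne_zero
  have hpk0 : (p : ℚ_[p]) ^ k ≠ 0 := zpow_ne_zero k hp0
  have he1 : (1 : ℤ) ≤ (e : ℤ) := by exact_mod_cast absRamificationIdx_pos p (RescaledCompletion F p v hv)
  have hϖ0 : 0 < ‖(ϖ : RescaledCompletion F p v hv)‖ := norm_pos_iff.mpr ϖ.ne_zero
  have ht0 : t ≠ 0 := by
    rw [← norm_pos_iff, ht]; exact zpow_pos hϖ0 M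
  obtain ⟨z', hz', hz'p, hzz'⟩ := exists_primitive_norm_ge p hz hz0
  obtain ⟨hpu, hpup⟩ := p_smul_primitive p hp2 hu hu1
  -- the multiplier `y' = p^{k+1} • u * t⁻¹` and the element `t * y' = p^k • (p • u)`
  set y : RescaledCompletion F p v hv := ((p : ℚ_[p]) ^ (k + 1) • u) * t⁻¹ with hy_def
  have hty : t * y = (p : ℚ_[p]) ^ k • ((p : ℚ_[p]) • u) := by
    rw [hy_def, mul_comm, mul_assoc, inv_mul_cancel₀ ht0, mul_one, smul_smul, zpow_add_one₀ hp0]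
  -- `‖y‖ ≤ 1`: `‖p‖^{k+1} ≤ ‖ϖ‖^M` since `M ≤ e (k+1)` and `‖p‖ = ‖ϖ‖^e`
  have hy1 : ‖y‖ ≤ 1 := by
    rw [hy_def, norm_mul, norm_inv, norm_smul, ht, norm_zpow, Padic.norm_p, ← norm_pow_absRamificationIdx p (RescaledCompletion F p v hv) hϖ, ← he_def,
      ← zpow_natCast, ← zpow_mul]
    have hle : ‖(ϖ : RescaledCompletion F p v hv)‖ ^ ((e : ℤ) * (k + 1)) ≤ ‖(ϖ : RescaledCompletion F p v hv)‖ ^ M :=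
      zpow_le_zpow_right_of_le_one₀ hϖ0 hϖ.1.le (le_mul_ediv_sub_one_add_one he1 M)
    have hM0 : 0 < ‖(ϖ : RescaledCompletion F p v hv)‖ ^ M := zpow_pos hϖ0 M
    calc ‖(ϖ : RescaledCompletion F p v hv)‖ ^ ((e : ℤ) * (k + 1)) * ‖u‖ * (‖(ϖ : RescaledCompletion F p v hv)‖ ^ M)⁻¹ ≤ ‖(ϖ : RescaledCompletion F p v hv)‖ ^ M * 1 * (‖(ϖ : RescaledCompletion F p v hv)‖ ^ M)⁻¹ := by
          gcongr
      _ = 1 := by rw [mul_one, mul_inv_cancel₀ hM0.ne']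
  -- `t y` and `p^k • z'` are primitive at content `p^k`
  have hx : t * y ∈ ((p : ℚ_[p]) ^ k) • (logUnits (RescaledCompletion F p v hv) : Set (RescaledCompletion F p v hv)) := by
    rw [hty]; exact Set.smul_mem_smul_set hpu
  have hxp : t * y ∉ ((p : ℚ_[p]) * (p : ℚ_[p]) ^ k) • (logUnits (RescaledCompletion F p v hv) : Set (RescaledCompletion F p v hv)) := by
    rw [hty, mul_comm, ← smul_smul, Set.smul_mem_smul_set_iff₀ hpk0]; exact hpup
  have hw : (p : ℚ_[p]) ^ k • z' ∈ ((p : ℚ_[p]) ^ k) • (logUnits (RescaledCompletion F p v hv) : Set (RescaledCompletion F p v hv)) := Set.smul_mem_smul_set hz'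
  have hwp : (p : ℚ_[p]) ^ k • z' ∉ ((p : ℚ_[p]) * (p : ℚ_[p]) ^ k) • (logUnits (RescaledCompletion F p v hv) : Set (RescaledCompletion F p v hv)) := by
    rw [mul_comm, ← smul_smul, Set.smul_mem_smul_set_iff₀ hpk0]; exact hz'p
  obtain ⟨g, hg, hgx⟩ := exists_mem_ismDH_apply_eq_of_primitive hlog v hv hx hxp hw hwp
  refine ⟨g, hg, y, hy1, ?_⟩
  rw [hgx, norm_smul, norm_zpow]
  exact mul_le_mul_of_nonneg_left hzz' (by positivity)

end Place

/-! ## §3. The two movers at a fibre point `x ∣ p` of a pilot datum, read through the presentation `φ_x = id` -/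

section Setting

open NumberField IsDedekindDomain Literature.IUT.LogThetaLattice Literature.IUT.LogVolume Literature.NumberTheory.NumberFields
  Literature.NumberTheory.GaloisRepresentations.Ultrametric Summit.ABC.IUTFork.Thm311 Summit.ABC.IUTFork.Thm311.Real
  Summit.ABC.IUTFork.Cor312 Summit.ABC.IUTFork.Cor312.Setting Summit.ABC.IUTFork.Cor312Vol

variable {F : Type} [Field F] [NumberField F] (X : PilotData F) {logv : PadicLogs F} (hlog : LogvAnalytic logv)
  (M : Type) [Field M] [NumberField M]
  (archPk : ∀ (j : (thetaIndex X).Label) (vQ : (thetaIndex X).VQ), Set ((logShellsDH X logv).Packet j vQ))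
  (archSub : ∀ (j : (thetaIndex X).Label) (v : (thetaIndex X).V),
    Set ((logShellsDH X logv).Packet j ((thetaIndex X).over v)))
  (Ψ : ℤ → ∀ v : (thetaIndex X).V, v ∈ (thetaIndex X).Vbad → Set ((logShellsDH X logv).StarPacket v))
  (act : ℤ → ∀ v : (thetaIndex X).V, v ∈ (thetaIndex X).Vbad →
    (logShellsDH X logv).StarPacket v → Module.End ℚ ((logShellsDH X logv).StarPacket v))
  (Mmod : ℤ → ∀ j : (thetaIndex X).LabelStar, Set ((logShellsDH X logv).GlobalPacket j.1))
  (region : ℤ → ∀ j : (thetaIndex X).LabelStar, FinDivisor M → ∀ vQ : (thetaIndex X).VQ,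
    Set ((logShellsDH X logv).Packet j.1 vQ))
  (n : ℤ) {HT : Type} {LogLink : HT → HT → Type} {IsFull : ∀ {s t : HT}, LogLink s t → Prop}
  (lat : LGPGaussianLogThetaLattice LogLink IsFull)
  {Frd : Type} {IsoF : Frd → Frd → Type} {Ob : Frd → Type} {realify : Frd → Frd} {Strip : Type}
  {IsoS : Strip → Strip → Type} {Mv : ∀ v : (thetaIndex X).V, v ∈ (thetaIndex X).Vbad → Type}
  [∀ v h, Monoid (Mv v h)]
  (sig : GlobalLGPFrobenioidSignature (thetaIndex X).lstar (thetaIndex X).V (· ∈ (thetaIndex X).Vbad)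
    Frd IsoF Ob realify Strip IsoS Mv)
  (split : SplittingMonoids Mv) {ObΔ : Type} {N : ∀ v : (thetaIndex X).V, v ∈ (thetaIndex X).Vbad → Type}
  [∀ v h, Monoid (N v h)] (qData : QPilotData ObΔ N)
  (tq : ∀ (pp : Nat.Primes) (x : (thetaIndex X).Fibre (.inr pp)), haveI : Fact (pp : ℕ).Prime := ⟨pp.2⟩; kOf X pp.1 x)
  (t : ∀ (pp : Nat.Primes) (_ : Fin X.lstar) (x : (thetaIndex X).Fibre (.inr pp)),
    haveI : Fact (pp : ℕ).Prime := ⟨pp.2⟩; kOf X pp.1 x)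
  (htq0 : ∀ pp x, tq pp x ≠ 0)
  (htq1 : ∀ (pp : Nat.Primes) (x : (thetaIndex X).Fibre (.inr pp)),
    haveI : Fact (pp : ℕ).Prime := ⟨pp.2⟩; placeOf X pp.1 x ∉ X.S → ‖tq pp x‖ = 1)
  (col : ℤ → Column (logShellsDH X logv))
  -- the numeric dictionary of `SlotReachWindow`
  (e n₀ : ∀ pp : Nat.Primes, (thetaIndex X).Fibre (.inr pp) → ℕ)
  (lam : ∀ pp : Nat.Primes, (thetaIndex X).Fibre (.inr pp) → ℝ)
  (mΘ : ∀ pp : Nat.Primes, Fin (thetaIndex X).lstar → (thetaIndex X).Fibre (.inr pp) → ℤ)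
  (mq : ∀ pp : Nat.Primes, (thetaIndex X).Fibre (.inr pp) → ℤ)

/-- **THE DONOR MOVER AT A FIBRE POINT** (`p` odd), read through the presentation `φ_x = id`: at every `x ∣ p` with a certified outer radius
`p^{λ_x} ≤ ‖z‖`, `z ∈ log_p 𝒪_x^×`, some `g ∈ Real.ismDH logv x` and an integral multiplier `y` have `p^{λ_x + 1} ≤ ‖φ_x(g(φ_x⁻¹(1·y)))‖`.
[cite: WeilBNT1967, Ch. II §2, Th. 1] [cite: DupuyHilado2025, §4.9] -/
theorem exists_donor_mover_at (pp : Nat.Primes) (hp2 : 2 < (pp : ℕ)) (x : (thetaIndex X).Fibre (.inr pp))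
    (hrad : haveI : Fact (pp : ℕ).Prime := ⟨pp.2⟩
      ∃ z ∈ (logUnits (kOf X pp.1 x) : Set (kOf X pp.1 x)), ((pp : ℕ) : ℝ) ^ (lam pp x) ≤ ‖z‖) :
    haveI : Fact (pp : ℕ).Prime := ⟨pp.2⟩
    ∃ g ∈ ismDH logv x.1, ∃ y : kOf X pp.1 x, ‖y‖ ≤ 1 ∧
      ((pp : ℕ) : ℝ) ^ (lam pp x + 1) ≤ ‖(presAt X hlog pp).φ x (g (((presAt X hlog pp).φ x).symm ((1 : kOf X pp.1 x) * y)))‖ := by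
  haveI : Fact (pp : ℕ).Prime := ⟨pp.2⟩
  have hp0 : (0 : ℝ) < ((pp : ℕ) : ℝ) := by exact_mod_cast pp.2.pos
  obtain ⟨z, hz, hzn⟩ := hrad
  have hz0 : z ≠ 0 := norm_pos_iff.mp (lt_of_lt_of_le (Real.rpow_pos_of_pos hp0 _) hzn)
  obtain ⟨u, hu1, hu⟩ := RHSlotReach.exists_norm_le_one_not_mem_logUnits (pp : ℕ) (kOf X pp.1 x)
  obtain ⟨x1, hx⟩ := x
  rcases x1 with w | v
  · exact absurd hx (by simp [thetaIndex])
  · obtain ⟨g, hg, hgn⟩ := exists_donor_mover (hlog pp) v (natCast_mem_placeOf X pp.1 ⟨.inr v, hx⟩) hp2 hu hu1 hz hz0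
    refine ⟨g, hg, u, hu1, ?_⟩
    rw [one_mul, Real.rpow_add_one hp0.ne']
    calc ((pp : ℕ) : ℝ) ^ (lam pp ⟨.inr v, hx⟩) * ((pp : ℕ) : ℝ) ≤ ‖z‖ * ((pp : ℕ) : ℝ) :=
          mul_le_mul_of_nonneg_right hzn hp0.le
      _ = ((pp : ℕ) : ℝ) * ‖z‖ := mul_comm _ _
      _ ≤ _ := hgn

/-- **THE ACTIVE MOVER AT A BAD FIBRE POINT** (`p` odd): with `‖t_{Θ,i+1,w}‖ = p^{−mΘ/e_w}` (`e_w = ramIdx`) and a certified outer radius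
`p^{λ_w} ≤ ‖z‖`, some `g ∈ Real.ismDH logv w` and an integral `y` have `p^{λ_w − ⌊(mΘ−1)/e_w⌋} ≤ ‖φ_w(g(φ_w⁻¹(t_Θ·y)))‖`.
[cite: WeilBNT1967, Ch. II §2, Th. 1] [cite: DupuyHilado2025, §4.9] -/
theorem exists_active_mover_at (pp : Nat.Primes) (hp2 : 2 < (pp : ℕ)) (i : Fin (thetaIndex X).lstar)
    (w : (thetaIndex X).Fibre (.inr pp))
    (hrad : haveI : Fact (pp : ℕ).Prime := ⟨pp.2⟩
      ∃ z ∈ (logUnits (kOf X pp.1 w) : Set (kOf X pp.1 w)), ((pp : ℕ) : ℝ) ^ (lam pp w) ≤ ‖z‖)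
    (hΘ : haveI : Fact (pp : ℕ).Prime := ⟨pp.2⟩
      ‖t pp i w‖ = ((pp : ℕ) : ℝ) ^ (-(mΘ pp i w : ℝ) / (ramIdx F (placeOf X pp.1 w) : ℝ))) :
    haveI : Fact (pp : ℕ).Prime := ⟨pp.2⟩
    ∃ g ∈ ismDH logv w.1, ∃ y : kOf X pp.1 w, ‖y‖ ≤ 1 ∧
      ((pp : ℕ) : ℝ) ^ (lam pp w - (((mΘ pp i w - 1) / (ramIdx F (placeOf X pp.1 w) : ℤ) : ℤ) : ℝ)) ≤
        ‖(presAt X hlog pp).φ w (g (((presAt X hlog pp).φ w).symm (t pp i w * y)))‖ := by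
  haveI : Fact (pp : ℕ).Prime := ⟨pp.2⟩
  have hp0 : (0 : ℝ) < ((pp : ℕ) : ℝ) := by exact_mod_cast pp.2.pos
  obtain ⟨z, hz, hzn⟩ := hrad
  have hz0 : z ≠ 0 := norm_pos_iff.mp (lt_of_lt_of_le (Real.rpow_pos_of_pos hp0 _) hzn)
  obtain ⟨u, hu1, hu⟩ := RHSlotReach.exists_norm_le_one_not_mem_logUnits (pp : ℕ) (kOf X pp.1 w)
  obtain ⟨ϖ, hϖ, hnorm⟩ := exists_isUniformizer_rescaledCompletion F pp.1 (placeOf X pp.1 w) (natCast_mem_placeOf X pp.1 w)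
  have heK : absRamificationIdx (pp : ℕ) (kOf X pp.1 w) = ramIdx F (placeOf X pp.1 w) :=
    RHHeightClassGlue.absRamificationIdx_kOf X pp.1 w
  have he' : ((placeOf X pp.1 w).asIdeal.ramificationIdx ℤ : ℝ) = (ramIdx F (placeOf X pp.1 w) : ℝ) := by rw [ramIdx_eq]
  have hne : (ramIdx F (placeOf X pp.1 w) : ℝ) ≠ 0 := by exact_mod_cast ramIdx_ne_zero F (placeOf X pp.1 w)
  -- `‖t‖ = ‖ϖ‖^{mΘ}`
  have ht : ‖t pp i w‖ = ‖(ϖ : kOf X pp.1 w)‖ ^ (mΘ pp i w) := by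
    rw [hΘ, hnorm, ← Real.rpow_intCast, ← Real.rpow_mul hp0.le, he']
    congr 1
    field_simp
  -- the exponent bookkeeping `p^{λ − k} ≤ ‖p‖^k · ‖z‖`
  have hexp : ∀ k : ℤ, ((pp : ℕ) : ℝ) ^ (lam pp w - ((k : ℤ) : ℝ)) ≤ ‖((pp : ℕ) : ℚ_[pp])‖ ^ k * ‖z‖ := by
    intro k
    rw [Real.rpow_sub hp0, div_eq_mul_inv, ← Real.rpow_neg hp0.le, Padic.norm_p, inv_zpow', ← Real.rpow_intCast, mul_comm]
    push_cast
    exact mul_le_mul_of_nonneg_left hzn (Real.rpow_nonneg hp0.le _)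
  obtain ⟨x1, hx⟩ := w
  rcases x1 with w' | v
  · exact absurd hx (by simp [thetaIndex])
  · obtain ⟨g, hg, y, hy1, hgn⟩ :=
      exists_active_mover (hlog pp) v (natCast_mem_placeOf X pp.1 ⟨.inr v, hx⟩) hp2 hϖ hu hu1 hz hz0 ht
    have heK' : absRamificationIdx (pp : ℕ) (RescaledCompletion F (pp : ℕ) v (natCast_mem_placeOf X pp.1 ⟨.inr v, hx⟩)) =
        ramIdx F (placeOf X pp.1 ⟨.inr v, hx⟩) := heK
    rw [heK'] at hgn
    exact ⟨g, hg, y, hy1, (hexp _).trans hgn⟩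

end Setting

end Summit.ABC.IUTFork.Repair.RHSlotReachMoverOdd

end
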